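import Literature.NumberTheory.Transcendental.LinGroupK
import Mathlib.Algebra.MvPolynomial.Eval
import Mathlib.Algebra.Group.Units.Equiv
import Mathlib.LinearAlgebra.Dimension.Basic
import HarnessLib

/-!
# Transport of the `𝔾ₐ^{d₀} × 𝔾ₘ^{d₁}` vocabulary along a field isomorphism; the zero estimate is isomorphism-invariant

Topic `Literature/NumberTheory/Transcendental` (namespace `Literature.NumberTheory.Transcendental`,
grouping sub-namespace `LinGroupK`). Everything here is PROVED; definitions with bodies; no named
facts. For a field isomorphism `σ : K ≃+* K'` we transport every piece of the vocabulary of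
`LinGroupK.lean` — points (`ptMap σ`, a group isomorphism), tangent vectors (`tmap σ`, a
`σ`-semilinear bijection), polynomials (`MvPolynomial.map σ`), invariant derivations and words
(`map_invDeriv`, `map_wordDeriv`), algebraic orders of vanishing (`vanishesAlg_map_iff`),
Philippon's `Σ(n)` (`image_sumset`), connected algebraic subgroups (`ConnAlgSubgroup.mapEquiv`)
with their Lie algebras and dimensions, and the count of classes `card((Σ·G')/G')` — and conclude
that the zero-estimate predicate is invariant:

* `LinGroupK.ZeroEstimate.of_ringEquiv : (σ : K ≃+* K') → ZeroEstimate K d₀ d₁ → ZeroEstimate K' d₀ d₁`.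

This is the (trivial) "Lefschetz principle" step by which Philippon's zero estimate
[Philippon1986, Thm 2.1] — a purely algebraic statement, printed for "`K = ℂ` (or `ℂ_ℓ`)" and
proved in the tree over `ℂ` — passes to `ℚ̄_p ≃+* ℂ`
(`Literature/FieldTheory/AlgClosed/PadicAlgClEquivComplex.lean`), where the `p`-adic case of
Waldschmidt's Theorem 4.1 / Roy's Theorem 1 needs it ([Roy1992, §1]: "`K = ℂ` or `ℂ_p`").

## References

* [Philippon1986] P. Philippon, *Lemmes de zéros dans les groupes algébriques commutatifs*,
  Bull. Soc. Math. France 114 (1986), 355–383, §2 ("`K = ℂ` (ou `ℂ_ℓ`)"), Théorème 2.1.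
* [Roy1992] D. Roy, *Matrices whose coefficients are linear forms in logarithms*, J. Number Theory
  41 (1992) 22–47, Notations (p. 24), §1 Theorem 1 (p. 25).
-/

noncomputable section

open MvPolynomial Module Function

namespace Literature.NumberTheory.Transcendental

namespace LinGroupK

universe u v

variable {K : Type u} {K' : Type v} [Field K] [Field K'] (σ : K ≃+* K') {d₀ d₁ : ℕ}

/-! ### A semilinear bijection does not change `finrank` -/

/-- The rank of a submodule is invariant under an injective `σ`-semilinear map along a ring
isomorphism `σ`. [folklore] -/
theorem finrank_map_of_ringEquiv {M M' : Type*} [AddCommGroup M] [Module K M] [AddCommGroup M']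
    [Module K' M'] (f : M →ₛₗ[(σ : K →+* K')] M') (hf : Injective f) (p : Submodule K M) :
    finrank K' (p.map f) = finrank K p := by
  -- the additive bijection `p ≃+ p.map f`
  let j₀ : p → p.map f := fun x => ⟨f x, Submodule.mem_map_of_mem x.2⟩
  have hj₀ : Bijective j₀ := by
    constructor
    · intro x y hxy
      apply Subtype.ext
      apply hf
      simpa [j₀] using congrArg Subtype.val hxy
    · rintro ⟨y, hy⟩
      obtain ⟨x, hx, rfl⟩ := Submodule.mem_map.1 hy
      exact ⟨⟨x, hx⟩, rfl⟩
  let j : p ≃+ p.map f :=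
    { Equiv.ofBijective j₀ hj₀ with
      map_add' := fun x y => by
        apply Subtype.ext
        simp [j₀] }
  have h := lift_rank_eq_of_equiv_equiv (R := K) (R' := K') (M := p) (M' := p.map f)
    (σ : K → K') j σ.bijective (fun r m => by
      apply Subtype.ext
      simp [j, j₀, LinearMap.map_smulₛₗ])
  have h' := congrArg Cardinal.toNat h
  simp only [Cardinal.toNat_lift] at h'
  exact h'.symm

/-! ### Tangent vectors -/

/-- `σ` applied coordinatewise to `Lie G = K^{d₀} × K^{d₁}`: a `σ`-semilinear map. [folklore] -/
def tmap : ((Fin d₀ → K) × (Fin d₁ → K)) →ₛₗ[(σ : K →+* K')] ((Fin d₀ → K') × (Fin d₁ → K')) where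
  toFun w := (fun i => σ (w.1 i), fun j => σ (w.2 j))
  map_add' w w' := by ext <;> simp
  map_smul' c w := by ext <;> simp

/-- Components of `tmap`. [folklore] -/
@[simp] theorem tmap_apply_fst (w : (Fin d₀ → K) × (Fin d₁ → K)) (i : Fin d₀) :
    (tmap σ w).1 i = σ (w.1 i) := rfl

/-- Components of `tmap`. [folklore] -/
@[simp] theorem tmap_apply_snd (w : (Fin d₀ → K) × (Fin d₁ → K)) (j : Fin d₁) :
    (tmap σ w).2 j = σ (w.2 j) := rfl

/-- `tmap σ⁻¹ ∘ tmap σ = id`. [folklore] -/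
@[simp] theorem tmap_symm_tmap (w : (Fin d₀ → K) × (Fin d₁ → K)) :
    tmap σ.symm (tmap σ w) = w := by
  ext <;> simp [tmap]

/-- `tmap σ ∘ tmap σ⁻¹ = id`. [folklore] -/
@[simp] theorem tmap_tmap_symm (w : (Fin d₀ → K') × (Fin d₁ → K')) :
    tmap σ (tmap σ.symm w) = w := by
  ext <;> simp [tmap]

/-- `tmap σ` is injective. [folklore] -/
theorem tmap_injective : Injective (tmap (d₀ := d₀) (d₁ := d₁) σ) := fun w w' h => by
  simpa using congrArg (tmap σ.symm) h

/-- `tmap σ` is surjective. [folklore] -/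
theorem tmap_surjective : Surjective (tmap (d₀ := d₀) (d₁ := d₁) σ) := fun w =>
  ⟨tmap σ.symm w, tmap_tmap_symm σ w⟩

/-- Round trip for subspaces: `(W.map σ⁻¹).map σ = W`. [folklore] -/
theorem map_tmap_map_tmap_symm (W : Submodule K' ((Fin d₀ → K') × (Fin d₁ → K'))) :
    (W.map (tmap σ.symm)).map (tmap σ) = W := by
  ext w
  simp only [Submodule.mem_map]
  constructor
  · rintro ⟨_, ⟨x, hx, rfl⟩, rfl⟩
    simpa using hx
  · intro hw
    exact ⟨tmap σ.symm w, ⟨w, hw, rfl⟩, by simp⟩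

/-- Membership in a transported subspace. [folklore] -/
theorem mem_map_tmap_iff (W : Submodule K ((Fin d₀ → K) × (Fin d₁ → K))) (w : (Fin d₀ → K) × (Fin d₁ → K)) :
    tmap σ w ∈ W.map (tmap σ) ↔ w ∈ W := by
  constructor
  · rintro ⟨x, hx, h⟩
    rwa [← tmap_injective σ h]
  · exact fun h => Submodule.mem_map_of_mem h

/-- `finrank` of a transported subspace. [folklore] -/
theorem finrank_map_tmap (W : Submodule K ((Fin d₀ → K) × (Fin d₁ → K))) :
    finrank K' (W.map (tmap σ)) = finrank K W :=
  finrank_map_of_ringEquiv σ _ (tmap_injective σ) W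

/-! ### Points -/

/-- `σ` applied coordinatewise to `G(K) = K^{d₀} × (Kˣ)^{d₁}`: a group isomorphism onto `G(K')`.
[folklore] -/
def ptMap : LinGroupK K d₀ d₁ ≃* LinGroupK K' d₀ d₁ :=
  MulEquiv.prodCongr
    (AddEquiv.toMultiplicative (AddEquiv.piCongrRight fun _ : Fin d₀ => (σ : K ≃+ K')))
    (MulEquiv.piCongrRight fun _ : Fin d₁ => Units.mapEquiv (σ : K ≃* K'))

/-- Additive coordinates of `ptMap σ g`. [folklore] -/
@[simp] theorem toAdd_ptMap_fst (g : LinGroupK K d₀ d₁) (i : Fin d₀) :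
    Multiplicative.toAdd (ptMap σ g).1 i = σ (Multiplicative.toAdd g.1 i) := rfl

/-- Multiplicative coordinates of `ptMap σ g`. [folklore] -/
@[simp] theorem coe_ptMap_snd (g : LinGroupK K d₀ d₁) (j : Fin d₁) :
    ((ptMap σ g).2 j : K') = σ (g.2 j : K) := rfl

/-- `coord (ptMap σ g) = σ ∘ coord g`. [folklore] -/
theorem coord_ptMap (g : LinGroupK K d₀ d₁) : coord (ptMap σ g) = σ ∘ coord g := by
  funext v
  rcases v with i | j <;> rfl

/-- Round trip on points. [folklore] -/
@[simp] theorem ptMap_symm_ptMap (g : LinGroupK K d₀ d₁) : ptMap σ.symm (ptMap σ g) = g := by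
  refine Prod.ext ?_ ?_
  · apply Multiplicative.toAdd.injective
    funext i
    simp
  · funext j
    ext
    simp

/-- Round trip on points. [folklore] -/
@[simp] theorem ptMap_ptMap_symm (g : LinGroupK K' d₀ d₁) : ptMap σ (ptMap σ.symm g) = g := by
  refine Prod.ext ?_ ?_
  · apply Multiplicative.toAdd.injective
    funext i
    simp
  · funext j
    ext
    simp

/-- Round trip on sets of points. [folklore] -/
theorem image_ptMap_image_ptMap_symm (S : Set (LinGroupK K' d₀ d₁)) :
    ptMap σ '' (ptMap σ.symm '' S) = S := by
  ext g
  simp only [Set.mem_image]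
  constructor
  · rintro ⟨_, ⟨x, hx, rfl⟩, rfl⟩
    simpa using hx
  · intro hg
    exact ⟨ptMap σ.symm g, ⟨g, hg, rfl⟩, by simp⟩

/-! ### Polynomials: evaluation, degrees -/

/-- **Evaluation commutes with transport**: `(σP)(σg) = σ(P(g))`. [folklore] -/
theorem evalAt_map (P : MvPolynomial (Fin d₀ ⊕ Fin d₁) K) (g : LinGroupK K d₀ d₁) :
    evalAt (map (σ : K →+* K') P) (ptMap σ g) = σ (evalAt P g) := by
  rw [evalAt_eq_eval, evalAt_eq_eval, coord_ptMap, eval_map]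
  have h := eval₂_comp_left (σ : K →+* K') (RingHom.id K) (coord g) P
  rw [RingHom.comp_id] at h
  exact h.symm

/-- Round trip on polynomials. [folklore] -/
@[simp] theorem map_map_symm (P : MvPolynomial (Fin d₀ ⊕ Fin d₁) K') :
    map (σ : K →+* K') (map (σ.symm : K' →+* K) P) = P := by
  rw [map_map]
  have : (σ : K →+* K').comp (σ.symm : K' →+* K) = RingHom.id K' := by
    ext x
    simp
  rw [this, map_id]

/-- Round trip on polynomials. [folklore] -/
@[simp] theorem map_symm_map (P : MvPolynomial (Fin d₀ ⊕ Fin d₁) K) :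
    map (σ.symm : K' →+* K) (map (σ : K →+* K') P) = P := by
  rw [map_map]
  have : (σ.symm : K' →+* K).comp (σ : K →+* K') = RingHom.id K := by
    ext x
    simp
  rw [this, map_id]

/-- `σP ≠ 0 ↔ P ≠ 0`. [folklore] -/
theorem map_ne_zero_iff (P : MvPolynomial (Fin d₀ ⊕ Fin d₁) K) :
    map (σ : K →+* K') P ≠ 0 ↔ P ≠ 0 := by
  rw [Ne, Ne, not_iff_not]
  constructor
  · intro h
    exact map_injective _ σ.injective (by rw [h, map_zero])
  · rintro rfl
    exact map_zero _

/-- Transport preserves `degX`. [folklore] -/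
@[simp] theorem degX_map (P : MvPolynomial (Fin d₀ ⊕ Fin d₁) K) : degX (map (σ : K →+* K') P) = degX P := by
  rw [degX, degX, support_map_of_injective _ σ.injective]

/-- Transport preserves `degY`. [folklore] -/
@[simp] theorem degY_map (P : MvPolynomial (Fin d₀ ⊕ Fin d₁) K) : degY (map (σ : K →+* K') P) = degY P := by
  rw [degY, degY, support_map_of_injective _ σ.injective]

/-! ### Invariant derivations and words -/

/-- **Transport of invariant derivations**: `σ(D_w P) = D_{σw}(σP)`. [folklore] -/
theorem map_invDeriv (w : (Fin d₀ → K) × (Fin d₁ → K)) (P : MvPolynomial (Fin d₀ ⊕ Fin d₁) K) :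
    map (σ : K →+* K') (invDeriv w P) = invDeriv (tmap σ w) (map (σ : K →+* K') P) := by
  induction P using MvPolynomial.induction_on with
  | C a => simp
  | add p q hp hq => rw [map_add, map_add, map_add, map_add, hp, hq]
  | mul_X p v hp =>
    have key : map (σ : K →+* K') (invDeriv w (X v)) =
        invDeriv (tmap σ w) (X v : MvPolynomial (Fin d₀ ⊕ Fin d₁) K') := by
      rcases v with i | j
      · rw [invDeriv_X_inl, invDeriv_X_inl, map_C]
        rfl
      · rw [invDeriv_X_inr, invDeriv_X_inr, map_mul, map_C, map_X]
        rfl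
    rw [Derivation.leibniz, smul_eq_mul, smul_eq_mul, map_add, map_mul, map_mul, hp, key, map_X,
      map_mul, map_X, Derivation.leibniz, smul_eq_mul, smul_eq_mul]

/-- **Transport of words**: `σ(D_u P) = D_{σu}(σP)`. [folklore] -/
theorem map_wordDeriv {k : ℕ} (u : Fin k → (Fin d₀ → K) × (Fin d₁ → K))
    (P : MvPolynomial (Fin d₀ ⊕ Fin d₁) K) :
    map (σ : K →+* K') (wordDeriv u P) = wordDeriv (fun i => tmap σ (u i)) (map (σ : K →+* K') P) := by
  induction k generalizing P with
  | zero => rfl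
  | succ k ih =>
    rw [wordDeriv_succ, wordDeriv_succ, ih, map_invDeriv]
    rfl

/-- **Transport of the algebraic order of vanishing.** [folklore] -/
theorem vanishesAlg_map_iff (P : MvPolynomial (Fin d₀ ⊕ Fin d₁) K)
    (W : Submodule K ((Fin d₀ → K) × (Fin d₁ → K))) (g : LinGroupK K d₀ d₁) (N : ℕ) :
    VanishesAlg (map (σ : K →+* K') P) (W.map (tmap σ)) (ptMap σ g) N ↔ VanishesAlg P W g N := by
  constructor
  · intro h k hk u hu
    have h1 := h k hk (fun i => tmap σ (u i)) (fun i => Submodule.mem_map_of_mem (hu i))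
    rw [← map_wordDeriv, evalAt_map] at h1
    exact σ.injective (by rw [h1, map_zero])
  · intro h k hk u' hu'
    -- pull the letters back
    have hu : ∀ i, tmap σ.symm (u' i) ∈ W := fun i => by
      obtain ⟨x, hx, hx'⟩ := Submodule.mem_map.1 (hu' i)
      rw [← hx', tmap_symm_tmap]
      exact hx
    have h1 := h k hk (fun i => tmap σ.symm (u' i)) hu
    have h2 : (fun i => tmap σ (tmap σ.symm (u' i))) = u' := funext fun i => tmap_tmap_symm σ _
    rw [← h2, ← map_wordDeriv, evalAt_map, h1, map_zero]

/-! ### `Σ(n)` -/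

/-- `σ(Σ(n)) = (σΣ)(n)`. [folklore] -/
theorem image_sumset (S : Set (LinGroupK K d₀ d₁)) (n : ℕ) :
    ptMap σ '' sumset S n = sumset (ptMap σ '' S) n := by
  ext g
  simp only [Set.mem_image, sumset, Set.mem_setOf_eq]
  constructor
  · rintro ⟨_, ⟨τ, hτ, rfl⟩, rfl⟩
    exact ⟨fun i => ptMap σ (τ i), fun i => ⟨τ i, hτ i, rfl⟩, by rw [map_prod]⟩
  · rintro ⟨τ', hτ', rfl⟩
    choose τ hτ hτ' using hτ'
    refine ⟨∏ i, τ i, ⟨τ, hτ, rfl⟩, ?_⟩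
    rw [map_prod]
    exact Finset.prod_congr rfl fun i _ => hτ' i

/-! ### Connected algebraic subgroups -/

/-- `σ` applied coordinatewise to `K^{d₀}`. [folklore] -/
def vmap (n : ℕ) : (Fin n → K) →ₛₗ[(σ : K →+* K')] (Fin n → K') where
  toFun v := fun i => σ (v i)
  map_add' v v' := by ext; simp
  map_smul' c v := by ext; simp

/-- Components of `vmap`. [folklore] -/
@[simp] theorem vmap_apply {n : ℕ} (v : Fin n → K) (i : Fin n) : vmap σ n v i = σ (v i) := rfl

/-- `vmap σ` is injective. [folklore] -/
theorem vmap_injective (n : ℕ) : Injective (vmap σ n) := fun v v' h => by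
  funext i
  exact σ.injective (by simpa using congrFun h i)

/-- Round trip for `vmap`. [folklore] -/
@[simp] theorem vmap_symm_vmap {n : ℕ} (v : Fin n → K) : vmap σ.symm n (vmap σ n v) = v := by
  funext i; simp

/-- Round trip for `vmap`. [folklore] -/
@[simp] theorem vmap_vmap_symm {n : ℕ} (v : Fin n → K') : vmap σ n (vmap σ.symm n v) = v := by
  funext i; simp

namespace ConnAlgSubgroup

/-- **Transport of a connected algebraic subgroup**: `E ↦ σE`, same characters. [folklore] -/
def mapEquiv (H : ConnAlgSubgroup K d₀ d₁) : ConnAlgSubgroup K' d₀ d₁ where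
  addPart := H.addPart.map (vmap σ d₀)
  chars := H.chars
  saturated := H.saturated

/-- Characters are unchanged. [folklore] -/
@[simp] theorem chars_mapEquiv (H : ConnAlgSubgroup K d₀ d₁) : (H.mapEquiv σ).chars = H.chars := rfl

/-- The vector part is transported. [folklore] -/
@[simp] theorem addPart_mapEquiv (H : ConnAlgSubgroup K d₀ d₁) :
    (H.mapEquiv σ).addPart = H.addPart.map (vmap σ d₀) := rfl

/-- Membership of transported points in the transported subgroup. [folklore] -/
theorem ptMap_mem_toSubgroup_iff (H : ConnAlgSubgroup K d₀ d₁) (g : LinGroupK K d₀ d₁) :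
    ptMap σ g ∈ (H.mapEquiv σ).toSubgroup ↔ g ∈ H.toSubgroup := by
  rw [mem_toSubgroup_iff, mem_toSubgroup_iff]
  have h1 : Multiplicative.toAdd (ptMap σ g).1 = vmap σ d₀ (Multiplicative.toAdd g.1) := rfl
  have h2 : ∀ χ : Fin d₁ → ℤ, (∏ j, (ptMap σ g).2 j ^ χ j) = Units.map (σ : K →* K') (∏ j, g.2 j ^ χ j) := by
    intro χ
    rw [map_prod]
    refine Finset.prod_congr rfl fun j _ => ?_
    rw [map_zpow]
    rfl
  refine and_congr ?_ (forall_congr' fun χ => forall_congr' fun _ => ?_)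
  · rw [h1, addPart_mapEquiv]
    constructor
    · rintro ⟨x, hx, h⟩
      rwa [← vmap_injective σ d₀ h]
    · exact fun h => Submodule.mem_map_of_mem h
  · rw [h2]
    constructor
    · intro h
      have := congrArg (Units.map (σ.symm : K' →* K)) h
      rw [map_one] at this
      rw [← this]
      ext
      simp
    · intro h
      rw [h, map_one]

/-- The transported subgroup is the image subgroup. [folklore] -/
theorem map_toSubgroup (H : ConnAlgSubgroup K d₀ d₁) :
    H.toSubgroup.map ((ptMap σ : LinGroupK K d₀ d₁ ≃* LinGroupK K' d₀ d₁) :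
      LinGroupK K d₀ d₁ →* LinGroupK K' d₀ d₁) = (H.mapEquiv σ).toSubgroup := by
  ext g'
  rw [Subgroup.mem_map]
  constructor
  · rintro ⟨g, hg, rfl⟩
    exact (ptMap_mem_toSubgroup_iff σ H g).2 hg
  · intro hg'
    refine ⟨ptMap σ.symm g', ?_, by simp⟩
    rw [← ptMap_mem_toSubgroup_iff σ, ptMap_ptMap_symm]
    exact hg'

/-- `Lie` of the transported torus part. [folklore] -/
theorem torusTangent_mapEquiv (H : ConnAlgSubgroup K d₀ d₁) :
    (H.mapEquiv σ).torusTangent = H.torusTangent.map (vmap σ d₁) := by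
  ext v'
  rw [mem_torusTangent_iff, Submodule.mem_map]
  simp only [chars_mapEquiv]
  constructor
  · intro h
    refine ⟨vmap σ.symm d₁ v', ?_, by simp⟩
    rw [mem_torusTangent_iff]
    intro χ hχ
    have := congrArg σ.symm (h χ hχ)
    simpa [map_sum] using this
  · rintro ⟨v, hv, rfl⟩ χ hχ
    have := congrArg σ ((mem_torusTangent_iff H v).1 hv χ hχ)
    simpa [map_sum] using this

/-- `Lie` of the transported subgroup. [folklore] -/
theorem tangent_mapEquiv (H : ConnAlgSubgroup K d₀ d₁) :
    (H.mapEquiv σ).tangent = H.tangent.map (tmap σ) := by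
  ext w'
  rw [mem_tangent_iff, torusTangent_mapEquiv, Submodule.mem_map]
  simp only [addPart_mapEquiv]
  constructor
  · rintro ⟨h0, h1⟩
    obtain ⟨a, ha, ha'⟩ := Submodule.mem_map.1 h0
    obtain ⟨v, hv, hv'⟩ := h1
    refine ⟨(a, v), (mem_tangent_iff H _).2 ⟨ha, hv⟩, ?_⟩
    ext i
    · simpa using congrFun ha' i
    · simpa using congrFun hv' i
  · rintro ⟨w, hw, rfl⟩
    have hw' : w.1 ∈ H.addPart ∧ w.2 ∈ H.torusTangent := (mem_tangent_iff H w).1 hw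
    exact ⟨Submodule.mem_map_of_mem (f := vmap σ d₀) hw'.1, ⟨w.2, hw'.2, rfl⟩⟩

/-- Transport preserves `dim E`. [folklore] -/
@[simp] theorem addDim_mapEquiv (H : ConnAlgSubgroup K d₀ d₁) : (H.mapEquiv σ).addDim = H.addDim :=
  finrank_map_of_ringEquiv σ _ (vmap_injective σ d₀) _

/-- Transport preserves `dim T'`. [folklore] -/
@[simp] theorem torusDim_mapEquiv (H : ConnAlgSubgroup K d₀ d₁) : (H.mapEquiv σ).torusDim = H.torusDim := by
  rw [torusDim, torusTangent_mapEquiv]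
  exact finrank_map_of_ringEquiv σ _ (vmap_injective σ d₁) _

/-- Transport preserves `dim (W ∩ Lie G')`. [folklore] -/
theorem finrank_inf_tangent_mapEquiv (H : ConnAlgSubgroup K d₀ d₁)
    (W : Submodule K ((Fin d₀ → K) × (Fin d₁ → K))) :
    finrank K' ↥(W.map (tmap σ) ⊓ (H.mapEquiv σ).tangent) = finrank K ↥(W ⊓ H.tangent) := by
  rw [tangent_mapEquiv, ← Submodule.map_inf _ (tmap_injective σ)]
  exact finrank_map_tmap σ _

/-- Transport preserves the number of classes `card((Σ·G')/G')`. [folklore] -/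
theorem ncard_classes_mapEquiv (H : ConnAlgSubgroup K d₀ d₁) (S : Set (LinGroupK K d₀ d₁)) :
    Set.ncard ((QuotientGroup.mk : LinGroupK K' d₀ d₁ → LinGroupK K' d₀ d₁ ⧸ (H.mapEquiv σ).toSubgroup) ''
        (ptMap σ '' S)) =
      Set.ncard ((QuotientGroup.mk : LinGroupK K d₀ d₁ → LinGroupK K d₀ d₁ ⧸ H.toSubgroup) '' S) := by
  set e := QuotientGroup.congr H.toSubgroup (H.mapEquiv σ).toSubgroup (ptMap σ) (map_toSubgroup σ H)
  have key : (QuotientGroup.mk : LinGroupK K' d₀ d₁ → LinGroupK K' d₀ d₁ ⧸ (H.mapEquiv σ).toSubgroup) ''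
      (ptMap σ '' S) = e '' ((QuotientGroup.mk : LinGroupK K d₀ d₁ → _ ⧸ H.toSubgroup) '' S) := by
    rw [Set.image_image, Set.image_image]
    refine Set.image_congr fun g _ => ?_
    rw [QuotientGroup.congr_mk]
  rw [key, Set.ncard_image_of_injective _ e.injective]

end ConnAlgSubgroup

/-! ### The zero estimate is invariant under field isomorphisms -/

/-- **`ZeroEstimate` is transported along `σ : K ≃+* K'`.** Pull the data over `K'` back to `K`
by `σ⁻¹`, apply the zero estimate over `K`, push the obstruction subgroup forward by `σ`.
[folklore] -/
theorem ZeroEstimate.of_ringEquiv (σ : K ≃+* K') (h : ZeroEstimate K d₀ d₁) : ZeroEstimate K' d₀ d₁ := by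
  obtain ⟨c, hc⟩ := h
  refine ⟨c, ?_⟩
  intro D₀ D₁ T W' S' P' hD₀ hD₁ hW' hS' h1' hP' hX' hY' hvan'
  -- the data over `K`
  set W : Submodule K ((Fin d₀ → K) × (Fin d₁ → K)) := W'.map (tmap σ.symm) with hWdef
  set S : Set (LinGroupK K d₀ d₁) := ptMap σ.symm '' S' with hSdef
  set P : MvPolynomial (Fin d₀ ⊕ Fin d₁) K := map (σ.symm : K' →+* K) P' with hPdef
  have hWW : W.map (tmap σ) = W' := map_tmap_map_tmap_symm σ W'
  have hSS : ptMap σ '' S = S' := image_ptMap_image_ptMap_symm σ S'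
  have hPP : map (σ : K →+* K') P = P' := map_map_symm σ P'
  -- hypotheses over `K`
  have hW : 0 < finrank K W := by rwa [← finrank_map_tmap σ W, hWW]
  have hS : S.Finite := hS'.image _
  have h1 : (1 : LinGroupK K d₀ d₁) ∈ S := ⟨1, h1', map_one _⟩
  have hP : P ≠ 0 := by rwa [← map_ne_zero_iff σ P, hPP]
  have hX : degX P ≤ D₀ := by rwa [← degX_map σ P, hPP]
  have hY : degY P ≤ D₁ := by rwa [← degY_map σ P, hPP]
  have hvan : ∀ g ∈ sumset S (d₀ + d₁), VanishesAlg P W g ((d₀ + d₁) * T + 1) := by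
    intro g hg
    rw [← vanishesAlg_map_iff σ, hWW, hPP]
    apply hvan'
    rw [← hSS, ← image_sumset]
    exact Set.mem_image_of_mem _ hg
  obtain ⟨H, ⟨g, hg⟩, hineq⟩ := hc D₀ D₁ T W S P hD₀ hD₁ hW hS h1 hP hX hY hvan
  refine ⟨H.mapEquiv σ, ⟨ptMap σ g, fun h' hh' => ?_⟩, ?_⟩
  · -- `h' = σ h` with `h ∈ H`
    have hh : ptMap σ.symm h' ∈ H.toSubgroup := by
      rw [← ConnAlgSubgroup.ptMap_mem_toSubgroup_iff σ, ptMap_ptMap_symm]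
      exact hh'
    have := hg _ hh
    have e : ptMap σ g * h' = ptMap σ (g * ptMap σ.symm h') := by rw [map_mul, ptMap_ptMap_symm]
    rw [e, ← hPP, evalAt_map, this, map_zero]
  · rw [← hWW, ← hSS, finrank_map_tmap, ConnAlgSubgroup.finrank_inf_tangent_mapEquiv,
      ConnAlgSubgroup.ncard_classes_mapEquiv, ConnAlgSubgroup.addDim_mapEquiv,
      ConnAlgSubgroup.torusDim_mapEquiv]
    exact hineq

end LinGroupK

end Literature.NumberTheory.Transcendental
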